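import Summits.BirchSwinnertonDyer.BirchSwinnertonDyer.Theses.TeichmullerTwistDescent
import Summits.BirchSwinnertonDyer.Rank1Residual.X2.IsogenyClassStability
import Summits.BirchSwinnertonDyer.Rank1Residual.X12.CMIsogenyInvariance
import Literature.NumberTheory.Automorphic.ShimuraCurveRibetTakahashiOptimalModularityProofs
import HarnessLib

/-!
# Route `TeichmullerTwistDescent`, support item `WeilTypeManinGlue` (G-WT, stmt-BirchSwinnertonDyer-22640)

Cell `pub/bsd-wall` (D-0145 line, W-ALL lane 3, row 2), seat `bsd-line-ttd-p1` (prover, g0).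
THEOREMS ONLY (no definition, no named fact, no `sorry`). BSD is not proved by this; no leaf is
proved by this: the file discharges the typed GLUE obligation of the route, i.e. that the two
Weil-type Manin cells PSMU (principal series, every `p ≥ 5`) and SCMU57 (supercuspidal, `p ∈ {5,7}`)
compose into the binders `hres` of AKR's Manin residue `ManinFrameResidueProperR` for every `p ≥ 5`.

WHAT THE ITEM ASKS. Modularity (`exists_isNewformOf`) → PSMU → SCMU57 → for every globally minimal
elliptic `W/ℚ`, prime `p ≥ 5` additive for `W` with `E[p]` irreducible, on AKR's residue
(`(p < 11 ∨ ∃ W' ∼ W (G)-ordinary at p with v_p(Δ') ≤ 4) ∧ (∃ W' ∼ W without Iₙ* fibre at p)`)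
some globally minimal member `W₀ ∼ W` carries a parametrisation datum `D₀` at level `N(W)` with
`p ∤ c(D₀)`.

PROOF (tree lemmas only, as planned in the route thesis). The `X₀(N)`-optimal member: modularity
gives a globally minimal `W₀ ∼ W` with a datum `D₀` at level `N(W)` of minimal degree among all data
with the same newform (`exists_optimal_modularParametrizationData_of_modularity`), and minimal degree
forces the lattice clause `Λ_{W₀} ⊆ c₀ Λ_f` (`latticeEq_of_forall_modularDegree_le`, Knapp 1993
Prop. 12.9(a)). `Addv`/`Irr` move along the isogeny (`X2.addv_iff_of_isIsogenous`,
`X12.irr_iff_of_isIsogenous`), and the class-level hypotheses (some member (G)-ordinary / some member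
without `Iₙ*` fibre) move from `W` to `W₀` by symmetry and transitivity of isogeny. Case split on
whether SOME `W' ∼ W₀` is (G)-ordinary at `p`: if so, PSMU at `(W₀, p, N(W), D₀)`; if not, the second
disjunct of `hres.1` is contradicted, so `p < 11`, hence `p ∈ {5, 7}` (`p` prime, `p ≥ 5`), and
SCMU57 at `(W₀, p, N(W), D₀)`.

References: [BCDTJAMS2001, Thm. A] (modularity, the antecedent); [Knapp1993, Prop. 12.9(a)]
(minimal degree ⇒ lattice-optimal); [CesnaviciusNeururerSaha2023, §1] (context: Manin constant and
modular degree).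
-/

set_option autoImplicit false
-- single-conjunct summit: `Summit.BirchSwinnertonDyer.BirchSwinnertonDyer.…` repeats the name by design
set_option linter.dupNamespace false

namespace Summit.BirchSwinnertonDyer.BirchSwinnertonDyer.Theorems.WeilTypeManinGlue

open Literature.NumberTheory.EllipticCurves Literature.NumberTheory.EllipticCurves.ModularForms
open Literature.NumberTheory.EllipticCurves.Rank1Residual
open Literature.NumberTheory.DiophantineGeometry
open IsDedekindDomain Rat.HeightOneSpectrum
open Summit.BirchSwinnertonDyer.Rank1Residual
open Summit.BirchSwinnertonDyer.BirchSwinnertonDyer.Theses.TeichmullerTwistDescent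

/-- A prime `p` with `5 ≤ p < 11` is `5` or `7`. -/
theorem eq_five_or_eq_seven_of_prime_of_five_le_of_lt_eleven {p : ℕ} (hp : p.Prime) (h5 : 5 ≤ p)
    (h11 : p < 11) : p = 5 ∨ p = 7 := by
  interval_cases p <;> first | (left; rfl) | (right; rfl) | (exfalso; revert hp; decide)

/-- **The optimal member of the class, with its lattice-optimal datum, carrying the frame
hypotheses.** For `W/ℚ` globally minimal elliptic, `p` prime, under modularity there is a globally
minimal `W₀ ∼ W` with a datum `D₀` at level `N(W)` satisfying the lattice clause
`Λ_{W₀} ⊆ c₀ Λ_f`; `Addv`/`Irr` at `p` transfer from `W` to `W₀`. -/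
theorem exists_optimal_member_latticeEq (hnf : exists_isNewformOf)
    (W : WeierstrassCurve ℚ) [W.IsElliptic] [W.IsGloballyMinimal] (p : ℕ) [Fact p.Prime]
    [NeZero (W.conductorNorm ℤ)] (hadd : Addv W p) (hirr : Irr W p) :
    ∃ (W₀ : WeierstrassCurve ℚ) (_ : W₀.IsElliptic) (_ : W₀.IsGloballyMinimal)
      (D₀ : ModularParametrizationData W₀ (W.conductorNorm ℤ)),
      WeierstrassCurve.IsIsogenous W W₀ ∧ Addv W₀ p ∧ Irr W₀ p ∧
        ∀ z ∈ D₀.L.lattice, ∃ w ∈ periodLattice D₀.f, z = D₀.c * w := by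
  obtain ⟨W₀, hW₀, hW₀min, D₀, _hfW, hisoW, hmin⟩ :=
    Literature.NumberTheory.Automorphic.exists_optimal_modularParametrizationData_of_modularity hnf
      (W.conductorNorm ℤ) W rfl
  haveI := hW₀
  haveI := hW₀min
  refine ⟨W₀, hW₀, hW₀min, D₀, hisoW, (X2.addv_iff_of_isIsogenous hisoW).mp hadd,
    (X12.irr_iff_of_isIsogenous hisoW p).mp hirr, ?_⟩
  exact D₀.latticeEq_of_forall_modularDegree_le hmin

/-- **G-WT, the Weil-type Manin glue (stmt-BirchSwinnertonDyer-22640), PROVED from tree lemmas.**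
Modularity → PSMU → SCMU57 → on AKR's Manin residue (binders `hres` of `ManinFrameResidueProperR`
verbatim, every `p ≥ 5`) some globally minimal member `W₀ ∼ W` carries a datum at level `N(W)` with
`p ∤ c(D₀)`. The member is the `X₀(N)`-optimal curve of the class with its minimal-degree (hence
lattice-optimal) datum; the case split is on whether some member of the class is (G)-ordinary at `p`
(principal series: PSMU) or none is (then `hres.1` forces `p < 11`, i.e. `p ∈ {5,7}`: SCMU57). -/
theorem weilTypeManinGlue_proof : WeilTypeManinGlue := by
  unfold WeilTypeManinGlue
  intro hnf hPS hSC W _ _ p _ _ hp5 hadd hirr hres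
  obtain ⟨W₀, hW₀, hW₀min, D₀, hisoW, hadd₀, hirr₀, hopt⟩ :=
    exists_optimal_member_latticeEq hnf W p hadd hirr
  haveI := hW₀
  haveI := hW₀min
  have hp : p.Prime := Fact.out
  -- the class-level hypotheses move from `W` to `W₀`
  have hsymm : WeierstrassCurve.IsIsogenous W₀ W := hisoW.symm_of_charZero
  have hIst₀ : ∃ (W' : WeierstrassCurve ℚ) (_ : W'.IsElliptic) (_ : W'.IsGloballyMinimal),
      WeierstrassCurve.IsIsogenous W₀ W' ∧ ∀ (v : HeightOneSpectrum ℤ) (n : ℕ),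
        natGenerator v = p → W'.kodairaSymbolAt v ≠ KodairaSymbol.Istar n := by
    obtain ⟨W', hW', hW'min, hiso', hK⟩ := hres.2
    exact ⟨W', hW', hW'min, hsymm.trans' hiso', hK⟩
  refine ⟨W₀, hW₀, hW₀min, D₀, hisoW, ?_⟩
  by_cases hG : ∃ (W' : WeierstrassCurve ℚ) (_ : W'.IsElliptic) (_ : W'.IsGloballyMinimal),
      WeierstrassCurve.IsIsogenous W₀ W' ∧ Additive.TypeGOrd W' p
  · -- principal-series cell: PSMU at the optimal member
    exact hPS W₀ p (W.conductorNorm ℤ) D₀ hp5 hadd₀ hirr₀ hG hIst₀ hopt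
  · -- supercuspidal cell: no (G)-ordinary member, so `hres.1` gives `p < 11`, i.e. `p ∈ {5, 7}`
    have h11 : p < 11 := by
      rcases hres.1 with h | ⟨W', hW', hW'min, hiso', hG', _⟩
      · exact h
      · exact absurd ⟨W', hW', hW'min, hsymm.trans' hiso', hG'⟩ hG
    have h57 : p = 5 ∨ p = 7 := eq_five_or_eq_seven_of_prime_of_five_le_of_lt_eleven hp hp5 h11
    have hnone : ∀ (W' : WeierstrassCurve ℚ) [W'.IsElliptic] [W'.IsGloballyMinimal],
        WeierstrassCurve.IsIsogenous W₀ W' → ¬ Additive.TypeGOrd W' p := by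
      intro W' _ _ hiso' hG'
      exact hG ⟨W', ‹_›, ‹_›, hiso', hG'⟩
    exact hSC W₀ p (W.conductorNorm ℤ) D₀ h57 hadd₀ hirr₀ hnone hIst₀ hopt

end Summit.BirchSwinnertonDyer.BirchSwinnertonDyer.Theorems.WeilTypeManinGlue
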